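import Mathlib.CategoryTheory.Equivalence
import Mathlib.CategoryTheory.Limits.FormalCoproducts.Basic
import Mathlib.CategoryTheory.ObjectProperty.FullSubcategory
import Mathlib.CategoryTheory.Widesubcategory
import Mathlib.CategoryTheory.MorphismProperty.Composition
import Mathlib.SetTheory.Cardinal.Finite
import Literature.AlgebraicGeometry.Frobenioids.Categories
import HarnessLib

/-!
# [IUTchI] §0 Notations and Conventions — "Monoids and Categories", categorical part

Mochizuki, *Inter-universal Teichmüller theory I: construction of Hodge theaters*,
kurims manuscript (May 2020), §0 "Notations and Conventions", paragraph
**Monoids and Categories**, kurims pp. 33–35 [cite: Mochizuki2012, §0 pp.33-35]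
(D-0012 claim key; the series' status is DISPUTED — the conventions recorded here are
plain category theory and take no side).

Typed here, one declaration per printed notion:

* "isomorphism `C → D`" := an isomorphism class of equivalences `C → D` (p. 33) —
  `equivSetoid`, `CatIsomorphism`;
* poly-morphisms, poly-isomorphisms, poly-automorphisms, the full poly-isomorphism,
  composites of poly-morphisms (p. 33) — `PolyHom`, `PolyHom.IsPolyIso`, `PolyHom.full`,
  `PolyHom.comp`, `PolyIso`;
* capsules `{A_j}_{j ∈ J}` of objects of `C`, `|J|`-capsules, `π₀`, morphisms of capsules
  and the category `Capsule(C)`, capsule-full poly-morphisms / poly-isomorphisms (pp. 33–34)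
  — `IsCapsule`, `PreCapsule` (= `C^⊥` of [FrdI] §0), `Capsule`, `Capsule.π₀`, `Capsule.IsCardCapsule`, `Capsule.fullPoly`,
  `Capsule.fullPolyIso`;
* "abstractly equivalent" isomorphism classes of functors (p. 35) — `AbstractlyEquivalent`.

Design: §0 opens with "We shall use the notation and terminology concerning monoids and
categories of [FrdI], §0", so this file imports the tree's [FrdI] §0 dictionary
(`Literature.AlgebraicGeometry.Frobenioids.Categories`).  A capsule `{A_j}_{j ∈ J}` is LITERALLY
an object of `C^⊥` there (`FiniteCoproductCompletion C` = Mathlib's `Limits.FormalCoproduct C`,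
an indexed family `obj : I → C`, cut out by `Finite I`); a morphism of capsules — "an injection
`ι : J ↪ J'` together with, for each `j ∈ J`, a morphism `A_j → A'_{ι(j)}`" — is LITERALLY a
morphism of `C^⊥` whose index map `Hom.f` is injective, so `Capsule C` is the wide subcategory
of `C^⊥` on the injective index maps.  Poly-morphisms are subsets of `Hom`; we keep both
`Set (A ⟶ B)` and, for poly-isomorphisms, `Set (A ≅ B)` with the evident bridge.

Deliberately NOT here: the word "isomorph" (an isomorphic copy — no content to type); the
remark that an "isomorphism `C → D`" is an isomorphism of the coarsified 2-category of
[FrdI] Appendix Def. A.1 (ii) (prose); the paragraph's remaining notions `B(X)`, `B^temp(Π)`,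
tempered groups, connected temperoids, their morphisms and the correspondence (a)–(c)
(p. 34–35) are in the companion file `ConventionsTemperoids.lean`; "Numbers" / "Curves"
(pp. 35–36) in `ConventionsNumbers.lean`.  No printed statement is strengthened.
-/

namespace Literature.IUT.HodgeTheaters

open CategoryTheory

universe w v v₁ v₂ v₃ v₄ u u₁ u₂ u₃ u₄

/-! ### "Isomorphisms" between categories (p. 33) -/

section CatIsomorphism

variable (C : Type u₁) [Category.{v₁} C] (D : Type u₂) [Category.{v₂} D]

/-- Two equivalences of categories `C ≌ D` are *isomorphic* when their underlying functors
are naturally isomorphic (an isomorphism in the 2-category of categories; the inverse data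
of an equivalence is determined up to isomorphism by the functor).  This is the setoid whose
classes are Mochizuki's "isomorphisms `C → D`" (IUTchI §0 p. 33).
[cite: Mochizuki2012, §0 p.33] -/
def equivSetoid : Setoid (C ≌ D) where
  r e e' := Nonempty (e.functor ≅ e'.functor)
  iseqv :=
    { refl := fun e => ⟨Iso.refl e.functor⟩
      symm := fun ⟨i⟩ => ⟨i.symm⟩
      trans := fun ⟨i⟩ ⟨j⟩ => ⟨i.trans j⟩ }

/-- An "isomorphism `C → D`" in the sense of IUTchI §0 p. 33: an *isomorphism class of
equivalences of categories* `C → D`.  [Note (loc. cit.): this differs from the standard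
terminology of category theory.]  [cite: Mochizuki2012, §0 p.33] -/
def CatIsomorphism : Type (max u₁ u₂ v₁ v₂) := Quotient (equivSetoid C D)

variable {C D}

/-- The "isomorphism `C → D`" determined by an equivalence. [cite: Mochizuki2012, §0 p.33] -/
def CatIsomorphism.mk (e : C ≌ D) : CatIsomorphism C D := Quotient.mk _ e

/-- Two equivalences determine the same "isomorphism `C → D`" iff their functors are
naturally isomorphic. [cite: Mochizuki2012, §0 p.33] -/
theorem CatIsomorphism.mk_eq_mk_iff (e e' : C ≌ D) :
    CatIsomorphism.mk e = CatIsomorphism.mk e' ↔ Nonempty (e.functor ≅ e'.functor) :=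
  Quotient.eq (r := equivSetoid C D)

end CatIsomorphism

/-! ### Poly-morphisms (p. 33) -/

section Poly

variable {C : Type u} [Category.{v} C]

/-- A *poly-morphism* `A → B`: a collection of morphisms `A → B`, i.e. a subset of the set
of morphisms `A → B` (IUTchI §0 p. 33). [cite: Mochizuki2012, §0 p.33] -/
abbrev PolyHom (A B : C) : Type v := Set (A ⟶ B)

namespace PolyHom

variable {A B D E : C}

/-- A poly-morphism is a *poly-isomorphism* if all of the morphisms in the collection are
isomorphisms (IUTchI §0 p. 33). [cite: Mochizuki2012, §0 p.33] -/
def IsPolyIso (P : PolyHom A B) : Prop := ∀ f ∈ P, IsIso f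

/-- A *poly-automorphism*: a poly-isomorphism `A ⥲ A` (IUTchI §0 p. 33).
[cite: Mochizuki2012, §0 p.33] -/
def IsPolyAut (P : PolyHom A A) : Prop := P.IsPolyIso

/-- The *full poly-isomorphism* `A ⥲ B`: the poly-morphism given by the collection of ALL
isomorphisms `A ⥲ B` (IUTchI §0 p. 33). [cite: Mochizuki2012, §0 p.33] -/
def full (A B : C) : PolyHom A B := {f | IsIso f}

/-- The *composite* of a poly-morphism `{f_i : A → B}_{i ∈ I}` with a poly-morphism
`{g_j : B → C}_{j ∈ J}`: the poly-morphism given by the SET (multiplicities ignored)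
`{g_j ∘ f_i}_{(i,j) ∈ I × J}` (IUTchI §0 p. 33). [cite: Mochizuki2012, §0 p.33] -/
def comp (P : PolyHom A B) (Q : PolyHom B D) : PolyHom A D :=
  Set.image2 (fun f g => f ≫ g) P Q

/-- The poly-morphism consisting of a single morphism. [cite: Mochizuki2012, §0 p.33] -/
def single (f : A ⟶ B) : PolyHom A B := {f}

/-- Membership in a composite poly-morphism, unfolded. [cite: Mochizuki2012, §0 p.33] -/
theorem mem_comp {P : PolyHom A B} {Q : PolyHom B D} {h : A ⟶ D} :
    h ∈ P.comp Q ↔ ∃ f ∈ P, ∃ g ∈ Q, f ≫ g = h := Set.mem_image2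

/-- The full poly-isomorphism is a poly-isomorphism. [cite: Mochizuki2012, §0 p.33] -/
theorem full_isPolyIso (A B : C) : (full A B).IsPolyIso := fun _ hf => hf

/-- Composition of poly-morphisms is associative (the index set `(I × J) × K` versus
`I × (J × K)` is invisible once multiplicities are ignored). [cite: Mochizuki2012, §0 p.33] -/
theorem comp_assoc (P : PolyHom A B) (Q : PolyHom B D) (R : PolyHom D E) :
    (P.comp Q).comp R = P.comp (Q.comp R) := by
  ext h
  simp only [mem_comp]
  constructor
  · rintro ⟨fg, ⟨f, hf, g, hg, rfl⟩, r, hr, rfl⟩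
    exact ⟨f, hf, g ≫ r, ⟨g, hg, r, hr, rfl⟩, by simp⟩
  · rintro ⟨f, hf, gr, ⟨g, hg, r, hr, rfl⟩, rfl⟩
    exact ⟨f ≫ g, ⟨f, hf, g, hg, rfl⟩, r, hr, by simp⟩

/-- The composite of two poly-isomorphisms is a poly-isomorphism.
[cite: Mochizuki2012, §0 p.33] -/
theorem IsPolyIso.comp {P : PolyHom A B} {Q : PolyHom B D} (hP : P.IsPolyIso)
    (hQ : Q.IsPolyIso) : (P.comp Q).IsPolyIso := by
  rintro h ⟨f, hf, g, hg, rfl⟩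
  haveI := hP f hf
  haveI := hQ g hg
  exact IsIso.comp_isIso

/-- Composing the full poly-isomorphisms `A ⥲ B ⥲ D` gives the full poly-isomorphism
`A ⥲ D` as soon as SOME isomorphism `A ⥲ B` exists. [cite: Mochizuki2012, §0 p.33] -/
theorem full_comp_full (A B D : C) (e : A ≅ B) :
    (full A B).comp (full B D) = full A D := by
  ext h
  simp only [mem_comp, full, Set.mem_setOf_eq]
  constructor
  · rintro ⟨f, hf, g, hg, rfl⟩
    exact IsIso.comp_isIso
  · intro hh
    exact ⟨e.hom, inferInstance, e.inv ≫ h, IsIso.comp_isIso, by simp⟩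

end PolyHom

/-- A poly-isomorphism presented as a set of isomorphisms `A ≅ B` (the form in which
poly-isomorphisms are usually manipulated; cf. `PolyIso.toPolyHom`).
[cite: Mochizuki2012, §0 p.33] -/
abbrev PolyIso (A B : C) : Type v := Set (A ≅ B)

namespace PolyIso

variable {A B D : C}

/-- The poly-morphism underlying a set of isomorphisms. [cite: Mochizuki2012, §0 p.33] -/
def toPolyHom (P : PolyIso A B) : PolyHom A B := Iso.hom '' P

/-- The full poly-isomorphism as a set of isomorphisms: all of them.
[cite: Mochizuki2012, §0 p.33] -/
def full (A B : C) : PolyIso A B := Set.univ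

/-- Composite of poly-isomorphisms (multiplicities ignored). [cite: Mochizuki2012, §0 p.33] -/
def comp (P : PolyIso A B) (Q : PolyIso B D) : PolyIso A D :=
  Set.image2 (fun f g => f ≪≫ g) P Q

/-- The inverse poly-isomorphism `{f⁻¹}`. [cite: Mochizuki2012, §0 p.33] -/
def symm (P : PolyIso A B) : PolyIso B A := Iso.symm '' P

/-- The poly-morphism underlying a set of isomorphisms is a poly-isomorphism.
[cite: Mochizuki2012, §0 p.33] -/
theorem isPolyIso_toPolyHom (P : PolyIso A B) : P.toPolyHom.IsPolyIso := by
  rintro f ⟨e, -, rfl⟩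
  infer_instance

/-- `PolyIso.full` presents `PolyHom.full`. [cite: Mochizuki2012, §0 p.33] -/
theorem toPolyHom_full (A B : C) : (full A B).toPolyHom = PolyHom.full A B := by
  ext f
  simp only [toPolyHom, full, Set.image_univ, Set.mem_range, PolyHom.full, Set.mem_setOf_eq]
  constructor
  · rintro ⟨e, rfl⟩
    infer_instance
  · intro hf
    exact ⟨asIso f, rfl⟩

/-- `PolyIso.comp` presents `PolyHom.comp`. [cite: Mochizuki2012, §0 p.33] -/
theorem toPolyHom_comp (P : PolyIso A B) (Q : PolyIso B D) :
    (P.comp Q).toPolyHom = P.toPolyHom.comp Q.toPolyHom := by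
  ext h
  constructor
  · rintro ⟨e, ⟨e₁, he₁, e₂, he₂, rfl⟩, rfl⟩
    exact ⟨e₁.hom, ⟨e₁, he₁, rfl⟩, e₂.hom, ⟨e₂, he₂, rfl⟩, rfl⟩
  · rintro ⟨f, ⟨e₁, he₁, rfl⟩, g, ⟨e₂, he₂, rfl⟩, rfl⟩
    exact ⟨e₁ ≪≫ e₂, ⟨e₁, he₁, e₂, he₂, rfl⟩, rfl⟩

end PolyIso

end Poly

/-! ### Capsules (pp. 33–34) -/

section Capsules

open Limits Literature.AlgebraicGeometry.Frobenioids

variable {C : Type u} [Category.{v} C]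

/-- A *capsule* of objects of `C` is a finite collection `{A_j}_{j ∈ J}` of objects of `C`
(IUTchI §0 p. 33): as an object property of Mathlib's formal coproducts `⟨J, A⟩`, finiteness of
the index type `J` — the property cutting `C^⊥` out of `FormalCoproduct C` in the tree's [FrdI]
§0 dictionary (`finiteFormalCoproducts`), re-exported under the IUTchI name.
[cite: Mochizuki2012, §0 p.33] -/
abbrev IsCapsule : ObjectProperty (FormalCoproduct.{w} C) := finiteFormalCoproducts.{w} C

/-- Finite indexed families of objects of `C` with ALL morphisms of formal coproducts
(arbitrary index maps), i.e. `C^⊥` of [FrdI] §0 (`FiniteCoproductCompletion C`); the category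
`Capsule C` below is its wide subcategory of injective index maps.
[cite: Mochizuki2012, §0 p.34] -/
abbrev PreCapsule (C : Type u) [Category.{v} C] : Type (max u (w + 1)) :=
  FiniteCoproductCompletion.{w} C

/-- The defining property of a *morphism of capsules*
`{A_j}_{j ∈ J} → {A'_{j'}}_{j' ∈ J'}`: it "consists of an injection `ι : J ↪ J'`, together
with, for each `j ∈ J`, a morphism `A_j → A'_{ι(j)}`" (IUTchI §0 p. 34) — i.e. the index
map of the underlying morphism of formal coproducts is injective.
[cite: Mochizuki2012, §0 p.34] -/
def capsuleHom : MorphismProperty (PreCapsule.{w} C) := fun _ _ f => Function.Injective f.hom.f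

/-- Injective index maps contain identities and are stable under composition.
[cite: Mochizuki2012, §0 p.34] -/
instance capsuleHom_isMultiplicative : (capsuleHom.{w} (C := C)).IsMultiplicative where
  id_mem _ := Function.injective_id
  comp_mem _ _ hf hg := hg.comp hf

/-- `Capsule(C)`: the category whose objects are the capsules of objects of `C` and whose
morphisms are the morphisms of capsules (IUTchI §0 p. 34: "Thus, the capsules of objects
of `C` form a category `Capsule(C)`"). [cite: Mochizuki2012, §0 p.34] -/
abbrev Capsule (C : Type u) [Category.{v} C] : Type (max u (w + 1)) :=
  WideSubcategory (capsuleHom.{w} (C := C))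

namespace Capsule

/-- The capsule `{A_j}_{j ∈ J}` determined by a finite indexed family.
[cite: Mochizuki2012, §0 p.33] -/
def mk (J : Type w) [Finite J] (A : J → C) : Capsule.{w} C := ⟨⟨⟨J, A⟩, ‹Finite J›⟩⟩

/-- The index set: `π₀({A_j}_{j ∈ J}) := J` (IUTchI §0 p. 34).
[cite: Mochizuki2012, §0 p.34] -/
def π₀ (A : Capsule.{w} C) : Type w := A.obj.obj.I

/-- The index set of a capsule is finite. [cite: Mochizuki2012, §0 p.33] -/
instance finite_π₀ (A : Capsule.{w} C) : Finite A.π₀ := A.obj.property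

/-- The constituent `A_j` of a capsule `{A_j}_{j ∈ J}`. [cite: Mochizuki2012, §0 p.33] -/
def constituent (A : Capsule.{w} C) (j : A.π₀) : C := A.obj.obj.obj j

/-- A capsule with index set `J` is a `|J|`-capsule (IUTchI §0 p. 34): the cardinality of
the capsule. [cite: Mochizuki2012, §0 p.34] -/
noncomputable def card (A : Capsule.{w} C) : ℕ := Nat.card A.π₀

/-- `A` is an `n`-capsule. [cite: Mochizuki2012, §0 p.34] -/
def IsCardCapsule (n : ℕ) (A : Capsule.{w} C) : Prop := A.card = n

variable {A A' : Capsule.{w} C}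

/-- The injection `ι : J ↪ J'` between index sets underlying a morphism of capsules.
[cite: Mochizuki2012, §0 p.34] -/
def indexMap (f : A ⟶ A') : A.π₀ → A'.π₀ := f.hom.hom.f

/-- The index map of a morphism of capsules is injective (by definition).
[cite: Mochizuki2012, §0 p.34] -/
theorem indexMap_injective (f : A ⟶ A') : Function.Injective (indexMap f) := f.property

/-- The component `A_j → A'_{ι(j)}` of a morphism of capsules. [cite: Mochizuki2012, §0 p.34] -/
def component (f : A ⟶ A') (j : A.π₀) : A.constituent j ⟶ A'.constituent (indexMap f j) :=
  f.hom.hom.φ j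

/-- A morphism of capsules exists only if `|J| ≤ |J'|`. [cite: Mochizuki2012, §0 p.34] -/
theorem card_le_card_of_hom (f : A ⟶ A') : A.card ≤ A'.card :=
  Nat.card_le_card_of_injective _ (indexMap_injective f)

/-- The *capsule-full poly-morphism* `{A_j}_{j ∈ J} → {A'_{j'}}_{j' ∈ J'}` associated to a
[fixed] injection `ι : J ↪ J'`: the poly-morphism consisting of the morphisms of `Capsule(C)`
with index map `ι` given by collections of [arbitrary] ISOMORPHISMS `A_j ⥲ A'_{ι(j)}`,
`j ∈ J` (IUTchI §0 p. 34). [cite: Mochizuki2012, §0 p.34] -/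
def fullPoly (A A' : Capsule.{w} C) (ι : A.π₀ → A'.π₀) : PolyHom A A' :=
  {f | indexMap f = ι ∧ ∀ j, IsIso (component f j)}

/-- A *capsule-full poly-isomorphism*: a capsule-full poly-morphism whose associated
injection between index sets is a bijection (IUTchI §0 p. 34). [cite: Mochizuki2012, §0 p.34] -/
def fullPolyIso (A A' : Capsule.{w} C) (ι : A.π₀ ≃ A'.π₀) : PolyHom A A' := fullPoly A A' ι

/-- The capsule-full poly-morphism of a non-injective `ι` is empty (there are no such
morphisms of capsules). [cite: Mochizuki2012, §0 p.34] -/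
theorem fullPoly_eq_empty_of_not_injective (ι : A.π₀ → A'.π₀) (h : ¬ Function.Injective ι) :
    fullPoly A A' ι = ∅ := by
  ext f
  simp only [fullPoly, Set.mem_setOf_eq, Set.mem_empty_iff_false, iff_false, not_and]
  rintro rfl
  exact absurd (indexMap_injective f) h

/-- Build a morphism of capsules from an injection of index sets and components.
[cite: Mochizuki2012, §0 p.34] -/
def homMk (ι : A.π₀ → A'.π₀) (hι : Function.Injective ι)
    (φ : ∀ j, A.constituent j ⟶ A'.constituent (ι j)) : A ⟶ A' :=
  ⟨⟨⟨ι, φ⟩⟩, hι⟩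

/-- A morphism built from isomorphic components over `ι` lies in the capsule-full
poly-morphism of `ι`. [cite: Mochizuki2012, §0 p.34] -/
theorem homMk_mem_fullPoly (ι : A.π₀ → A'.π₀) (hι : Function.Injective ι)
    (φ : ∀ j, A.constituent j ≅ A'.constituent (ι j)) :
    homMk ι hι (fun j => (φ j).hom) ∈ fullPoly A A' ι :=
  ⟨rfl, fun j => (φ j).isIso_hom⟩

/-- Every member of a capsule-full poly-ISOmorphism is an isomorphism of `Capsule(C)`; in
particular a capsule-full poly-isomorphism is a poly-isomorphism.
[cite: Mochizuki2012, §0 p.34] -/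
theorem fullPolyIso_isPolyIso (ι : A.π₀ ≃ A'.π₀) : (fullPolyIso A A' ι).IsPolyIso := by
  rintro f ⟨hf, hiso⟩
  obtain ⟨⟨⟨g, φ⟩⟩, hinj⟩ := f
  change g = ⇑ι at hf
  subst hf
  change ∀ j, IsIso (φ j) at hiso
  -- the three levels: formal coproducts, the full subcategory, the wide subcategory
  let e₀ : A.obj.obj ≅ A'.obj.obj := FormalCoproduct.isoOfComponents ι fun j => asIso (φ j)
  have hinv : Function.Injective e₀.inv.f := fun x y hxy => ι.symm.injective hxy
  exact (CategoryTheory.isoMk (ObjectProperty.isoMk _ e₀) hinj hinv).isIso_hom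

end Capsule

end Capsules

/-! ### Abstractly equivalent functors (p. 35) -/

section AbstractlyEquivalent

variable {C₁ : Type u₁} [Category.{v₁} C₁] {C₂ : Type u₂} [Category.{v₂} C₂]
  {C₁' : Type u₃} [Category.{v₃} C₁'] {C₂' : Type u₄} [Category.{v₄} C₂']

/-- Two [isomorphism classes of] functors `φ : C₁ → C₂`, `φ' : C₁' → C₂'` are *abstractly
equivalent* if, for `i = 1, 2`, there exist isomorphisms [i.e. equivalences, up to
isomorphism] `α_i : C_i ⥲ C_i'` such that `φ' ∘ α₁ = α₂ ∘ φ` [as isomorphism classes of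
functors] (IUTchI §0 p. 35).  The relation depends only on the isomorphism classes of
`φ`, `φ'` (`AbstractlyEquivalent.of_iso`). [cite: Mochizuki2012, §0 p.35] -/
def AbstractlyEquivalent (φ : C₁ ⥤ C₂) (φ' : C₁' ⥤ C₂') : Prop :=
  ∃ (α₁ : C₁ ≌ C₁') (α₂ : C₂ ≌ C₂'), Nonempty (α₁.functor ⋙ φ' ≅ φ ⋙ α₂.functor)

/-- Abstract equivalence is invariant under replacing the functors by isomorphic ones.
[cite: Mochizuki2012, §0 p.35] -/
theorem AbstractlyEquivalent.of_iso {φ ψ : C₁ ⥤ C₂} {φ' ψ' : C₁' ⥤ C₂'} (e : φ ≅ ψ)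
    (e' : φ' ≅ ψ') (h : AbstractlyEquivalent φ φ') : AbstractlyEquivalent ψ ψ' := by
  obtain ⟨α₁, α₂, ⟨i⟩⟩ := h
  exact ⟨α₁, α₂, ⟨(Functor.isoWhiskerLeft α₁.functor e'.symm).trans
    (i.trans (Functor.isoWhiskerRight e α₂.functor))⟩⟩

/-- Every functor is abstractly equivalent to itself. [cite: Mochizuki2012, §0 p.35] -/
theorem AbstractlyEquivalent.refl (φ : C₁ ⥤ C₂) : AbstractlyEquivalent φ φ :=
  ⟨CategoryTheory.Equivalence.refl, CategoryTheory.Equivalence.refl,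
    ⟨(Functor.leftUnitor φ).trans (Functor.rightUnitor φ).symm⟩⟩

end AbstractlyEquivalent

end Literature.IUT.HodgeTheaters
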